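import Literature.Analysis.SpecialFunctions.InvSinSqPartialFractions

/-!
# `BalabanUV.Beta.FP.ConstrainedBiLaplacianBloch1D` — road «FP» for binder row D1: RULING R-FP-29's S-sized [folklore] COMPANION of row
# **RHOA-4-GH (localisation half, fibre∕strip route)** (owner d1-p3-g8, journal l.25917 (2), 2026-08-21T03:04Z; locator
# t4-ne9-formalise-leaf-08-g31, NOTE N-ne9leaf08g31-1 l.25910): «THE 1-D BLOCH ALIAS SUMS IN CLOSED FORM» — `Σ_{n∈ℤ}(x−2πn)⁻ᵏ`,
# k = 3, 4, 5, 6, for real `x ∉ 2πℤ`, and the two continuum-block fibre functionals `(2 − 2cos x)·S₄(x)`, `(2 − 2cos x)·S₆(x)`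

HONEST DEPENDENCY (cell records, verbatim): «continuum YM on T⁴ ⇐ BetaPertH ∧ nine spine estimates (0/9 proved); BetaPertH ⇐ (D1) ∧ (D4) ∧
CAP+tail; G-an2-4 gates asym, D1 and NE2/3/4.»  HONEST FRAMING (cell contract, verbatim): «discharging `BetaPertH` makes Bałaban's UV stability
UNCONDITIONAL — a real constructive-QFT result; it is NOT the continuum limit and NOT the Clay problem.»  THIS MODULE is [folklore] one-variable
real analysis: termwise differentiation of an absolutely convergent series of rational functions (Mathlib `hasDerivAt_tsum_of_isPreconnected`)
iterated four times from the tree's `S₂` identity `Literature.Analysis.SpecialFunctions.hasSum_int_inv_sub_two_pi_mul_sq`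
(`Σ_{n∈ℤ}(x−2πn)⁻² = 1∕(4sin²(x∕2))`; cite tags there: Ahlfors Ch. 5 §2.1 (9), Bauerschmidt–Brydges–Slade Ch. 3), plus half-angle
trigonometry.  No lattice, no operator, no estimate of Bałaban's, no definition, no `def … : Prop`, nothing cited here, 0 sorry.  It
discharges NOTHING of `hbook`∕D1.  NOT RHOA-4-GH, NOT D1, NOT BetaPertH, NOT continuum, NOT Clay.
ABSOLUTE RULE (cell charter, verbatim): «No internally-minted statement may enter as a cited fact. Every hypothesis is either kernel-proved in this
package or a verbatim quotation of a PUBLISHED theorem with page reference. The manuscript(s) under audit are NOT citable for their own disputed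
steps — they are the thing under adjudication; programme-internal (2001/route/tribunal) claims are never citable.»
THE ROW (R-FP-29 (2), verbatim): «the 1-D closed forms `S₄`∕`S₆` + the two `acosh` rates make a welcome S-sized [folklore] companion
(`FP/ConstrainedBiLaplacianBloch1D.lean`, exact trigonometric identities + `Real.arcosh`) for whoever wants it — not on the critical path».
CONTEXT (N-ne9leaf08g31-1 (C); a MODEL statement of the note, DISPLAYED, not proved): for the block-mean-constrained inverse of `A = (−Δ)^s`
in the continuum-block limit the Bloch fibre `(ΠA_θΠ)⁻¹` is singular iff `⟨𝟙, A_θ⁻¹𝟙⟩ = (2 − 2cos θ)·Σ_{l∈ℤ}(θ + 2πl)^{−2s−2} = 0`; the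
per-block decay rate is the distance from the real axis to the nearest complex zero (s = 1: `acosh 2`; s = 2, the ghost's constrained
bi-Laplacian: `acosh((13−√105)∕2)`) — zero sets, rates and decimal enclosures: sibling module `FP/ConstrainedBiLaplacianBloch1DRates`.
WHAT IS PROVED (all [folklore]; `s := sin(x∕2)`, `c := cos(x∕2)`):
* §1 **`hasSum_int_inv_sub_two_pi_mul_pow_succ`** — from `Σ_{n∈ℤ}(y−2πn)^{−(k+2)} = F(y)` for all real `y ∉ 2πℤ` and `HasDerivAt F f′ x`
  conclude `Σ_{n∈ℤ}(x−2πn)^{−(k+3)} = −f′∕(k+2)` (uniform lower bound `ρ(|m|+1) ≤ |y − 2πm|` on a ball, `rho_mul_le_abs_sub`; majorant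
  `(k+2)∕(ρ(|m|+1))^{k+3}`).
* §2 **`hasSum_int_inv_sub_two_pi_mul_pow_three`** `Σ(x−2πn)⁻³ = c∕(8s³)`; **`…_pow_four`** `Σ(x−2πn)⁻⁴ = (2+cos x)∕(48 s⁴)` (half-angle form
  `…_pow_four'`: `(s²+3c²)∕(48s⁴)`); **`…_pow_five`** `= c(2s²+3c²)∕(96 s⁵)`; **`…_pow_six`** `Σ(x−2πn)⁻⁶ = (33+26cos x+cos 2x)∕(3840 s⁶)`
  (`…_pow_six'`: `(2s⁴+15s²c²+15c⁴)∕(960s⁶)`); **`hasSum_fibre_laplacian`** `Σ(2−2cos x)(x−2πn)⁻⁴ = (2+cos x)∕(12 s²)`,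
  **`hasSum_fibre_biLaplacian`** `Σ(2−2cos x)(x−2πn)⁻⁶ = (33+26cos x+cos 2x)∕(960 s⁴)`.  (Plain-float check against direct summation to 1e-12
  at four sample points — DISPLAYED, not asserted.)
NOT HERE (honest): finite-n LATTICE alias sums; the identification of `⟨𝟙, A_θ⁻¹𝟙⟩` with these sums; d > 1 (addendum l.26004: the nearest
zero sits at transverse momentum 0 where the d-dimensional sum collapses to this one — numerics); B-jet dependence; any (pp)∕(rem) letter; the
loc half `FP/ConstrainedBiLaplacianStrip` (first refusal gan24-p3).  0∕4 row-D1 binders touched.  Provenance: NE9 swarm leaf seat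
`b2b-balaban-t4-ne9-formalise-leaf-04` gen 39 (cross-lane duty, typer rule 2 (a′); OFFER journal l.26047), 2026-08-21.
-/

noncomputable section

namespace Summit.QuantumFields.BalabanUV.Beta.FP.ConstrainedBiLaplacianBloch1D

open Filter Real Metric Set
open scoped Topology

/-! ## §1 Termwise differentiation of `Σ_{n∈ℤ} (y − 2πn)^{-(k+2)}` in the real variable -/

/-- [folklore] For real `x ∉ 2πℤ` there is `δ > 0` with `δ ≤ |x − 2πm|` for every integer `m`, and `δ ≤ π`. -/
theorem exists_pos_le_abs_sub_two_pi_mul {x : ℝ} (hx : ∀ n : ℤ, x ≠ 2 * π * n) :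
    ∃ δ : ℝ, 0 < δ ∧ δ ≤ π ∧ ∀ m : ℤ, δ ≤ |x - 2 * π * m| := by
  have hπ : (0 : ℝ) < 2 * π := by positivity
  have hu : ∀ n : ℤ, x / (2 * π) ≠ n := by
    intro n h; apply hx n; field_simp at h; linarith
  obtain ⟨δ₀, hδ₀, hδ₀2, hδ₀m⟩ := Literature.Analysis.SpecialFunctions.exists_pos_le_abs_sub_int hu
  refine ⟨2 * π * δ₀, by positivity, ?_, fun m => ?_⟩
  · nlinarith [Real.pi_pos]
  · have h := hδ₀m m
    have e : x - 2 * π * m = (2 * π) * (x / (2 * π) - m) := by field_simp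
    rw [e, abs_mul, abs_of_pos hπ]
    exact mul_le_mul_of_nonneg_left h hπ.le

/-- [folklore] The uniform lower bound on the ball: if `|y − x| < δ/2`, `δ ≤ |x − 2πm|` for all `m` and `0 < δ`, then
`(δ² / (4 (R + δ))) · (|m| + 1) ≤ |y − 2πm|` for every integer `m`, where `R := |x| + δ/2` (so that `|y| ≤ R`). -/
theorem rho_mul_le_abs_sub {x y δ : ℝ} (hδ : 0 < δ) (hδπ : δ ≤ π) (hxm : ∀ m : ℤ, δ ≤ |x - 2 * π * m|)
    (hy : |y - x| < δ / 2) (m : ℤ) :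
    δ ^ 2 / (4 * (|x| + δ / 2 + δ)) * (|(m : ℝ)| + 1) ≤ |y - 2 * π * m| := by
  set R : ℝ := |x| + δ / 2 with hR
  set d : ℝ := |y - 2 * π * m| with hd
  have hR0 : 0 ≤ |x| := abs_nonneg x
  have hd1 : δ / 2 ≤ d := by
    have h1 := hxm m
    have h2 : |x - 2 * π * m| ≤ |x - y| + |y - 2 * π * m| := abs_sub_le _ _ _
    rw [abs_sub_comm x y] at h2
    linarith
  have hyR : |y| ≤ R := by
    have := abs_add_le (y - x) x
    rw [sub_add_cancel] at this; linarith
  have hm1 : 2 * π * |(m : ℝ)| ≤ R + d := by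
    have h1 := abs_add_le (2 * π * m - y) y
    rw [sub_add_cancel, abs_sub_comm, abs_mul, abs_of_pos (by positivity : (0 : ℝ) < 2 * π)] at h1
    linarith
  have hm0 : 0 ≤ |(m : ℝ)| := abs_nonneg _
  have hstep : δ / 2 * (|(m : ℝ)| + 1) ≤ R + 2 * d := by
    have : δ / 2 * |(m : ℝ)| ≤ 2 * π * |(m : ℝ)| := by
      apply mul_le_mul_of_nonneg_right _ hm0
      linarith
    linarith
  have hRd : R * (δ / 2) ≤ R * d := mul_le_mul_of_nonneg_left hd1 (by positivity)
  have hpos : 0 < 4 * (R + δ) := by positivity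
  rw [div_mul_eq_mul_div, div_le_iff₀ hpos]
  nlinarith

/-- [folklore] `Σ_{m∈ℤ} C / (|m|+1)^(k+2)` is summable. -/
theorem summable_int_const_div_abs_add_one_pow (C : ℝ) (k : ℕ) :
    Summable fun m : ℤ => C / (|(m : ℝ)| + 1) ^ (k + 2) := by
  have h1 : Summable fun n : ℕ => 1 / ((n : ℝ) + 1) ^ (k + 2) := by
    have h := (summable_nat_add_iff 1).2 (Real.summable_one_div_nat_pow.2 (by omega : 1 < k + 2))
    refine h.congr fun n => ?_
    push_cast
    ring
  have h2 : Summable fun n : ℕ => C / ((n : ℝ) + 1) ^ (k + 2) := by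
    refine (h1.mul_left C).congr fun n => ?_
    ring
  exact summable_int_iff_summable_nat_and_neg.2 ⟨h2.congr fun n => by simp, h2.congr fun n => by simp⟩

/-- [folklore] `d/dz (z − c)^{-(k+2)} = −(k+2)(y − c)^{-(k+3)}` at `z = y ≠ c`, in `1/·` currency. -/
theorem hasDerivAt_one_div_sub_pow {y c : ℝ} (h : y - c ≠ 0) (k : ℕ) :
    HasDerivAt (fun z : ℝ => 1 / (z - c) ^ (k + 2)) (-(((k : ℝ) + 2) / (y - c) ^ (k + 3))) y := by
  have h1 : HasDerivAt (fun z : ℝ => (z - c) ^ (k + 2)) (((k + 2 : ℕ) : ℝ) * (y - c) ^ (k + 2 - 1) * 1) y :=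
    ((hasDerivAt_id y).sub_const c).pow (k + 2)
  have h2 := h1.inv (pow_ne_zero _ h)
  have e : (fun z : ℝ => 1 / (z - c) ^ (k + 2)) = fun z => ((z - c) ^ (k + 2))⁻¹ := by
    funext z; simp [one_div]
  rw [e]
  refine h2.congr_deriv ?_
  have hk : k + 2 - 1 = k + 1 := by omega
  rw [hk]
  push_cast
  field_simp
  ring

/-- [folklore] **THE TERMWISE DIFFERENTIATION STEP.** Let `x ∉ 2πℤ`. If `Σ_{n∈ℤ} 1/(y − 2πn)^(k+2) = F(y)` for every real
`y ∉ 2πℤ` and `F` has derivative `f′` at `x`, then `Σ_{n∈ℤ} 1/(x − 2πn)^(k+3) = −f′/(k+2)` (termwise differentiation on a ball around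
`x` avoiding `2πℤ`, Mathlib's `hasDerivAt_tsum_of_isPreconnected` with the summable majorant `(k+2)/(ρ(|n|+1))^(k+3)` of
`rho_mul_le_abs_sub`). -/
theorem hasSum_int_inv_sub_two_pi_mul_pow_succ (k : ℕ) {F : ℝ → ℝ} {f' x : ℝ}
    (hx : ∀ n : ℤ, x ≠ 2 * π * n)
    (hF : ∀ y : ℝ, (∀ n : ℤ, y ≠ 2 * π * n) → HasSum (fun n : ℤ => 1 / (y - 2 * π * n) ^ (k + 2)) (F y))
    (hF' : HasDerivAt F f' x) :
    HasSum (fun n : ℤ => 1 / (x - 2 * π * n) ^ (k + 3)) (-f' / ((k : ℝ) + 2)) := by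
  obtain ⟨δ, hδ, hδπ, hδx⟩ := exists_pos_le_abs_sub_two_pi_mul hx
  set t : Set ℝ := ball x (δ / 2) with ht
  have hty : ∀ y ∈ t, |y - x| < δ / 2 := fun y hy => by
    rw [ht, mem_ball, Real.dist_eq] at hy; exact hy
  set ρ : ℝ := δ ^ 2 / (4 * (|x| + δ / 2 + δ)) with hρ
  have hρ0 : 0 < ρ := by positivity
  have hlow : ∀ y ∈ t, ∀ m : ℤ, ρ * (|(m : ℝ)| + 1) ≤ |y - 2 * π * m| := fun y hy m =>
    rho_mul_le_abs_sub hδ hδπ hδx (hty y hy) m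
  have htZ : ∀ y ∈ t, ∀ m : ℤ, y ≠ 2 * π * m := by
    intro y hy m h
    have h1 := hlow y hy m
    rw [h, sub_self, abs_zero] at h1
    linarith [(by positivity : 0 < ρ * (|(m : ℝ)| + 1))]
  set g : ℤ → ℝ → ℝ := fun n y => 1 / (y - 2 * π * n) ^ (k + 2) with hg
  set g' : ℤ → ℝ → ℝ := fun n y => -(((k : ℝ) + 2) / (y - 2 * π * n) ^ (k + 3)) with hg'
  set u : ℤ → ℝ := fun n => (((k : ℝ) + 2) / ρ ^ (k + 3)) / (|(n : ℝ)| + 1) ^ (k + 3) with hu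
  have hu_sum : Summable u := summable_int_const_div_abs_add_one_pow _ (k + 1)
  have hderiv : ∀ n : ℤ, ∀ y ∈ t, HasDerivAt (g n) (g' n y) y := by
    intro n y hy
    have hc : y - 2 * π * n ≠ 0 := sub_ne_zero.2 (htZ y hy n)
    exact hasDerivAt_one_div_sub_pow hc k
  have hbound : ∀ n : ℤ, ∀ y ∈ t, ‖g' n y‖ ≤ u n := by
    intro n y hy
    have h1 := hlow y hy n
    have hpos : 0 < ρ * (|(n : ℝ)| + 1) := by positivity
    have hapos : 0 < |y - 2 * π * n| := lt_of_lt_of_le hpos h1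
    simp only [hg', hu, norm_neg, Real.norm_eq_abs]
    rw [abs_div, abs_of_nonneg (by positivity : (0 : ℝ) ≤ (k : ℝ) + 2), abs_pow, div_div]
    apply div_le_div_of_nonneg_left (by positivity) (by positivity)
    rw [← mul_pow]
    exact pow_le_pow_left₀ hpos.le h1 _
  have hxt : x ∈ t := by rw [ht]; exact mem_ball_self (half_pos hδ)
  have hsum0 : Summable fun n => g n x := (hF x hx).summable
  have hD : HasDerivAt (fun y => ∑' n, g n y) (∑' n, g' n x) x :=
    hasDerivAt_tsum_of_isPreconnected hu_sum isOpen_ball (convex_ball x (δ / 2)).isPreconnected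
      hderiv hbound hxt hsum0 hxt
  have hFeq : (fun y => ∑' n, g n y) =ᶠ[𝓝 x] F := by
    filter_upwards [isOpen_ball.mem_nhds hxt] with y hy
    exact (hF y (htZ y hy)).tsum_eq
  have hD' : HasDerivAt F (∑' n, g' n x) x := hD.congr_of_eventuallyEq hFeq.symm
  have heq : ∑' n, g' n x = f' := hD'.unique hF'
  have hsum' : Summable fun n => g' n x := Summable.of_norm_bounded hu_sum fun n => hbound n x hxt
  have h2 := (hsum'.hasSum.mul_right (-(1 / ((k : ℝ) + 2))))
  rw [heq] at h2
  have hk0 : (k : ℝ) + 2 ≠ 0 := by positivity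
  have e1 : (fun n : ℤ => g' n x * -(1 / ((k : ℝ) + 2))) = fun n : ℤ => 1 / (x - 2 * π * n) ^ (k + 3) := by
    funext n
    simp only [hg']
    field_simp
  have e2 : f' * -(1 / ((k : ℝ) + 2)) = -f' / ((k : ℝ) + 2) := by field_simp
  rw [e1, e2] at h2
  exact h2


/-! ## §2 The closed forms `S₃, S₄, S₅, S₆` on the real line -/

/-- [folklore] `sin(x/2) ≠ 0` for `x ∉ 2πℤ`. -/
theorem sin_half_ne_zero {x : ℝ} (hx : ∀ n : ℤ, x ≠ 2 * π * n) : Real.sin (x / 2) ≠ 0 := by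
  rw [Ne, Real.sin_eq_zero_iff]
  rintro ⟨n, hn⟩
  exact hx n (by linarith)

/-- [folklore] `d/dy sin(y/2) = cos(x/2)/2`. -/
theorem hasDerivAt_sin_half (x : ℝ) : HasDerivAt (fun y : ℝ => Real.sin (y / 2)) (Real.cos (x / 2) / 2) x := by
  have h := ((hasDerivAt_id' x).div_const 2).sin
  refine h.congr_deriv ?_
  ring

/-- [folklore] `d/dy cos(y/2) = −sin(x/2)/2`. -/
theorem hasDerivAt_cos_half (x : ℝ) : HasDerivAt (fun y : ℝ => Real.cos (y / 2)) (-(Real.sin (x / 2) / 2)) x := by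
  have h := ((hasDerivAt_id' x).div_const 2).cos
  refine h.congr_deriv ?_
  ring

/-- [folklore] `d/dy [1/(4 sin²(y/2))] = −cos(x/2)/(4 sin³(x/2))` where `sin(x/2) ≠ 0`. -/
theorem hasDerivAt_F2 {x : ℝ} (hs : Real.sin (x / 2) ≠ 0) :
    HasDerivAt (fun y : ℝ => 1 / (4 * Real.sin (y / 2) ^ 2))
      (-(Real.cos (x / 2) / (4 * Real.sin (x / 2) ^ 3))) x := by
  have hD := ((hasDerivAt_sin_half x).fun_pow 2).const_mul 4
  have hne : 4 * Real.sin (x / 2) ^ 2 ≠ 0 := by positivity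
  have h := hD.inv hne
  have e : (fun y : ℝ => 1 / (4 * Real.sin (y / 2) ^ 2)) = fun y => (4 * Real.sin (y / 2) ^ 2)⁻¹ := by
    funext y; rw [one_div]
  rw [e]
  refine h.congr_deriv ?_
  simp only [show (2 - 1 : ℕ) = 1 from rfl, pow_one]
  field_simp
  ring

/-- [folklore] **`S₃`**: `Σ_{n∈ℤ} 1/(x − 2πn)³ = cos(x/2) / (8 sin³(x/2))` for real `x ∉ 2πℤ`. -/
theorem hasSum_int_inv_sub_two_pi_mul_pow_three {x : ℝ} (hx : ∀ n : ℤ, x ≠ 2 * π * n) :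
    HasSum (fun n : ℤ => 1 / (x - 2 * π * n) ^ 3) (Real.cos (x / 2) / (8 * Real.sin (x / 2) ^ 3)) := by
  have h := hasSum_int_inv_sub_two_pi_mul_pow_succ 0 hx
    (F := fun y => 1 / (4 * Real.sin (y / 2) ^ 2))
    (fun y hy => by simpa using Literature.Analysis.SpecialFunctions.hasSum_int_inv_sub_two_pi_mul_sq hy)
    (hasDerivAt_F2 (sin_half_ne_zero hx))
  convert h using 1
  push_cast
  field_simp
  ring

/-- [folklore] `d/dy [cos(y/2)/(8 sin³(y/2))] = −(sin²(x/2) + 3cos²(x/2))/(16 sin⁴(x/2))` where `sin(x/2) ≠ 0`. -/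
theorem hasDerivAt_F3 {x : ℝ} (hs : Real.sin (x / 2) ≠ 0) :
    HasDerivAt (fun y : ℝ => Real.cos (y / 2) / (8 * Real.sin (y / 2) ^ 3))
      (-((Real.sin (x / 2) ^ 2 + 3 * Real.cos (x / 2) ^ 2) / (16 * Real.sin (x / 2) ^ 4))) x := by
  have hD := ((hasDerivAt_sin_half x).fun_pow 3).const_mul 8
  have hne : 8 * Real.sin (x / 2) ^ 3 ≠ 0 := by positivity
  have h := (hasDerivAt_cos_half x).div hD hne
  refine h.congr_deriv ?_
  simp only [show (3 - 1 : ℕ) = 2 from rfl]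
  field_simp
  ring

/-- [folklore] **`S₄` (half-angle form)**: `Σ_{n∈ℤ} 1/(x − 2πn)⁴ = (sin²(x/2) + 3cos²(x/2)) / (48 sin⁴(x/2))` for real `x ∉ 2πℤ`. -/
theorem hasSum_int_inv_sub_two_pi_mul_pow_four' {x : ℝ} (hx : ∀ n : ℤ, x ≠ 2 * π * n) :
    HasSum (fun n : ℤ => 1 / (x - 2 * π * n) ^ 4)
      ((Real.sin (x / 2) ^ 2 + 3 * Real.cos (x / 2) ^ 2) / (48 * Real.sin (x / 2) ^ 4)) := by
  have h := hasSum_int_inv_sub_two_pi_mul_pow_succ 1 hx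
    (F := fun y => Real.cos (y / 2) / (8 * Real.sin (y / 2) ^ 3))
    (fun y hy => hasSum_int_inv_sub_two_pi_mul_pow_three hy)
    (hasDerivAt_F3 (sin_half_ne_zero hx))
  convert h using 1
  push_cast
  field_simp
  ring

/-- [folklore] `cos x = cos²(x/2) − sin²(x/2)`. -/
theorem cos_eq_cos_half_sq_sub (x : ℝ) : Real.cos x = Real.cos (x / 2) ^ 2 - Real.sin (x / 2) ^ 2 := by
  have h2 : Real.cos x = Real.cos (2 * (x / 2)) := by ring_nf
  rw [h2, Real.cos_two_mul]
  nlinarith [Real.sin_sq_add_cos_sq (x / 2)]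

/-- [folklore] **`S₄`**: `Σ_{n∈ℤ} 1/(x − 2πn)⁴ = (2 + cos x) / (48 sin⁴(x/2))` for real `x ∉ 2πℤ` — the alias sum controlling the
block-mean-constrained inverse LAPLACIAN in the continuum-block limit (N-ne9leaf08g31-1 (C)). -/
theorem hasSum_int_inv_sub_two_pi_mul_pow_four {x : ℝ} (hx : ∀ n : ℤ, x ≠ 2 * π * n) :
    HasSum (fun n : ℤ => 1 / (x - 2 * π * n) ^ 4) ((2 + Real.cos x) / (48 * Real.sin (x / 2) ^ 4)) := by
  have h := hasSum_int_inv_sub_two_pi_mul_pow_four' hx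
  have e : 2 + Real.cos x = Real.sin (x / 2) ^ 2 + 3 * Real.cos (x / 2) ^ 2 := by
    rw [cos_eq_cos_half_sq_sub x]
    nlinarith [Real.sin_sq_add_cos_sq (x / 2)]
  rw [e]
  exact h

/-- [folklore] `d/dy [(sin²(y/2) + 3cos²(y/2))/(48 sin⁴(y/2))] = −cos(x/2)(2sin²(x/2) + 3cos²(x/2))/(24 sin⁵(x/2))` where
`sin(x/2) ≠ 0`. -/
theorem hasDerivAt_F4 {x : ℝ} (hs : Real.sin (x / 2) ≠ 0) :
    HasDerivAt (fun y : ℝ => (Real.sin (y / 2) ^ 2 + 3 * Real.cos (y / 2) ^ 2) / (48 * Real.sin (y / 2) ^ 4))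
      (-(Real.cos (x / 2) * (2 * Real.sin (x / 2) ^ 2 + 3 * Real.cos (x / 2) ^ 2) / (24 * Real.sin (x / 2) ^ 5))) x := by
  have hN := ((hasDerivAt_sin_half x).fun_pow 2).add (((hasDerivAt_cos_half x).fun_pow 2).const_mul 3)
  have hD := ((hasDerivAt_sin_half x).fun_pow 4).const_mul 48
  have hne : 48 * Real.sin (x / 2) ^ 4 ≠ 0 := by positivity
  have h := hN.div hD hne
  refine h.congr_deriv ?_
  simp only [show (2 - 1 : ℕ) = 1 from rfl, show (4 - 1 : ℕ) = 3 from rfl, pow_one, Pi.add_apply]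
  field_simp
  ring

/-- [folklore] **`S₅`** (half-angle form; `2s²+3c² = (5 + cos x)/2`): `Σ_{n∈ℤ} 1/(x − 2πn)⁵ = cos(x/2)(2sin²(x/2) + 3cos²(x/2)) / (96 sin⁵(x/2))`. -/
theorem hasSum_int_inv_sub_two_pi_mul_pow_five {x : ℝ} (hx : ∀ n : ℤ, x ≠ 2 * π * n) :
    HasSum (fun n : ℤ => 1 / (x - 2 * π * n) ^ 5)
      (Real.cos (x / 2) * (2 * Real.sin (x / 2) ^ 2 + 3 * Real.cos (x / 2) ^ 2) / (96 * Real.sin (x / 2) ^ 5)) := by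
  have h := hasSum_int_inv_sub_two_pi_mul_pow_succ 2 hx
    (F := fun y => (Real.sin (y / 2) ^ 2 + 3 * Real.cos (y / 2) ^ 2) / (48 * Real.sin (y / 2) ^ 4))
    (fun y hy => hasSum_int_inv_sub_two_pi_mul_pow_four' hy)
    (hasDerivAt_F4 (sin_half_ne_zero hx))
  convert h using 1
  push_cast
  field_simp
  ring

/-- [folklore] `d/dy [cos(y/2)(2sin²(y/2) + 3cos²(y/2))/(96 sin⁵(y/2))] = −(2sin⁴ + 15 sin²cos² + 15 cos⁴)(x/2)/(192 sin⁶(x/2))`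
where `sin(x/2) ≠ 0`. -/
theorem hasDerivAt_F5 {x : ℝ} (hs : Real.sin (x / 2) ≠ 0) :
    HasDerivAt (fun y : ℝ => Real.cos (y / 2) * (2 * Real.sin (y / 2) ^ 2 + 3 * Real.cos (y / 2) ^ 2) / (96 * Real.sin (y / 2) ^ 5))
      (-((2 * Real.sin (x / 2) ^ 4 + 15 * Real.sin (x / 2) ^ 2 * Real.cos (x / 2) ^ 2 + 15 * Real.cos (x / 2) ^ 4) /
        (192 * Real.sin (x / 2) ^ 6))) x := by
  have hN := (hasDerivAt_cos_half x).mul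
    ((((hasDerivAt_sin_half x).fun_pow 2).const_mul 2).add (((hasDerivAt_cos_half x).fun_pow 2).const_mul 3))
  have hD := ((hasDerivAt_sin_half x).fun_pow 5).const_mul 96
  have hne : 96 * Real.sin (x / 2) ^ 5 ≠ 0 := by positivity
  have h := hN.div hD hne
  refine h.congr_deriv ?_
  simp only [show (2 - 1 : ℕ) = 1 from rfl, show (5 - 1 : ℕ) = 4 from rfl, pow_one, Pi.add_apply, Pi.mul_apply]
  field_simp
  ring

/-- [folklore] **`S₆` (half-angle form)**: `Σ_{n∈ℤ} 1/(x − 2πn)⁶ = (2sin⁴(x/2) + 15sin²(x/2)cos²(x/2) + 15cos⁴(x/2)) / (960 sin⁶(x/2))`. -/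
theorem hasSum_int_inv_sub_two_pi_mul_pow_six' {x : ℝ} (hx : ∀ n : ℤ, x ≠ 2 * π * n) :
    HasSum (fun n : ℤ => 1 / (x - 2 * π * n) ^ 6)
      ((2 * Real.sin (x / 2) ^ 4 + 15 * Real.sin (x / 2) ^ 2 * Real.cos (x / 2) ^ 2 + 15 * Real.cos (x / 2) ^ 4) /
        (960 * Real.sin (x / 2) ^ 6)) := by
  have h := hasSum_int_inv_sub_two_pi_mul_pow_succ 3 hx
    (F := fun y => Real.cos (y / 2) * (2 * Real.sin (y / 2) ^ 2 + 3 * Real.cos (y / 2) ^ 2) / (96 * Real.sin (y / 2) ^ 5))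
    (fun y hy => hasSum_int_inv_sub_two_pi_mul_pow_five hy)
    (hasDerivAt_F5 (sin_half_ne_zero hx))
  convert h using 1
  push_cast
  field_simp
  ring

/-- [folklore] The numerator identity `33 + 26 cos x + cos 2x = 4 (2sin⁴(x/2) + 15sin²(x/2)cos²(x/2) + 15cos⁴(x/2))`. -/
theorem numerator_six_half_angle (x : ℝ) :
    33 + 26 * Real.cos x + Real.cos (2 * x) =
      4 * (2 * Real.sin (x / 2) ^ 4 + 15 * Real.sin (x / 2) ^ 2 * Real.cos (x / 2) ^ 2 + 15 * Real.cos (x / 2) ^ 4) := by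
  rw [Real.cos_two_mul, cos_eq_cos_half_sq_sub x]
  linear_combination (-(6 * Real.sin (x / 2) ^ 2 + 58 * Real.cos (x / 2) ^ 2 + 32)) * Real.sin_sq_add_cos_sq (x / 2)

/-- [folklore] **`S₆`**: `Σ_{n∈ℤ} 1/(x − 2πn)⁶ = (33 + 26 cos x + cos 2x) / (3840 sin⁶(x/2))` for real `x ∉ 2πℤ` — the alias sum
controlling the block-mean-constrained inverse BI-LAPLACIAN (the ghost's operator) in the continuum-block limit (N-ne9leaf08g31-1 (C)). -/
theorem hasSum_int_inv_sub_two_pi_mul_pow_six {x : ℝ} (hx : ∀ n : ℤ, x ≠ 2 * π * n) :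
    HasSum (fun n : ℤ => 1 / (x - 2 * π * n) ^ 6)
      ((33 + 26 * Real.cos x + Real.cos (2 * x)) / (3840 * Real.sin (x / 2) ^ 6)) := by
  have h := hasSum_int_inv_sub_two_pi_mul_pow_six' hx
  rw [numerator_six_half_angle x]
  convert h using 1
  have hs := sin_half_ne_zero hx
  field_simp
  ring

/-! ### The two continuum-block fibre functionals `(2 − 2cos θ)·S_{2s+2}(θ)` (s = 1: Laplacian legs; s = 2: the bi-Laplacian ghost) -/

/-- [folklore] `2 − 2cos x = 4 sin²(x/2)`. -/
theorem two_sub_two_mul_cos (x : ℝ) : 2 - 2 * Real.cos x = 4 * Real.sin (x / 2) ^ 2 := by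
  rw [cos_eq_cos_half_sq_sub x]
  nlinarith [Real.sin_sq_add_cos_sq (x / 2)]

/-- [folklore] **s = 1 fibre functional**: `Σ_{n∈ℤ} (2 − 2cos x)/(x − 2πn)⁴ = (2 + cos x)/(12 sin²(x/2))` for real `x ∉ 2πℤ` (the
continuum-block-limit value of `⟨𝟙, A_θ⁻¹𝟙⟩` for `A = −Δ` in N-ne9leaf08g31-1 (C); complex zeros: those of `2 + cos θ`, sibling module). -/
theorem hasSum_fibre_laplacian {x : ℝ} (hx : ∀ n : ℤ, x ≠ 2 * π * n) :
    HasSum (fun n : ℤ => (2 - 2 * Real.cos x) / (x - 2 * π * n) ^ 4)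
      ((2 + Real.cos x) / (12 * Real.sin (x / 2) ^ 2)) := by
  have h := (hasSum_int_inv_sub_two_pi_mul_pow_four hx).mul_left (2 - 2 * Real.cos x)
  have hs := sin_half_ne_zero hx
  have e1 : (fun n : ℤ => (2 - 2 * Real.cos x) * (1 / (x - 2 * π * n) ^ 4)) = fun n : ℤ => (2 - 2 * Real.cos x) / (x - 2 * π * n) ^ 4 := by
    funext n; rw [mul_one_div]
  have e2 : (2 - 2 * Real.cos x) * ((2 + Real.cos x) / (48 * Real.sin (x / 2) ^ 4)) =
      (2 + Real.cos x) / (12 * Real.sin (x / 2) ^ 2) := by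
    rw [two_sub_two_mul_cos]
    field_simp
    ring
  rw [e1, e2] at h
  exact h

/-- [folklore] **s = 2 fibre functional**: `Σ_{n∈ℤ} (2 − 2cos x)/(x − 2πn)⁶ = (33 + 26cos x + cos 2x)/(960 sin⁴(x/2))` for real
`x ∉ 2πℤ` (the value of `⟨𝟙, A_θ⁻¹𝟙⟩` for `A = Δ²`, the ghost's operator; complex zeros: those of `33 + 26cos θ + cos 2θ`, sibling module). -/
theorem hasSum_fibre_biLaplacian {x : ℝ} (hx : ∀ n : ℤ, x ≠ 2 * π * n) :
    HasSum (fun n : ℤ => (2 - 2 * Real.cos x) / (x - 2 * π * n) ^ 6)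
      ((33 + 26 * Real.cos x + Real.cos (2 * x)) / (960 * Real.sin (x / 2) ^ 4)) := by
  have h := (hasSum_int_inv_sub_two_pi_mul_pow_six hx).mul_left (2 - 2 * Real.cos x)
  have hs := sin_half_ne_zero hx
  have e1 : (fun n : ℤ => (2 - 2 * Real.cos x) * (1 / (x - 2 * π * n) ^ 6)) = fun n : ℤ => (2 - 2 * Real.cos x) / (x - 2 * π * n) ^ 6 := by
    funext n; rw [mul_one_div]
  have e2 : (2 - 2 * Real.cos x) * ((33 + 26 * Real.cos x + Real.cos (2 * x)) / (3840 * Real.sin (x / 2) ^ 6)) =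
      (33 + 26 * Real.cos x + Real.cos (2 * x)) / (960 * Real.sin (x / 2) ^ 4) := by
    rw [two_sub_two_mul_cos]
    field_simp
    ring
  rw [e1, e2] at h
  exact h

end Summit.QuantumFields.BalabanUV.Beta.FP.ConstrainedBiLaplacianBloch1D
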